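import Mathlib.Combinatorics.Hall.Basic
import Mathlib.Combinatorics.SetFamily.HarrisKleitman
import Mathlib.Data.Finset.Sups
import Summits.CriticalPhenomena.PercolationContinuityZ3.Theorems.PercNearOneGluingNoHeavyLowerTailSahiGridPatternZProfile
import HarnessLib

/-!
# `NoHeavyLowerTail` (crux stmt-CriticalPhenomena-4575), hull-port line hp-7: the FIBRE MATCHING LEMMA behind the
# 1-sum / 2-sum reduction of the coefficientwise (T*) statement J-BERN⁺

Support file (prover `prim-hp-7`, generation 45; `--supports stmt-CriticalPhenomena-4575`).  Pure finite combinatorics, no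
definitions, no `sorry`, standard axioms.

THE MATHEMATICS (memo `prim-hp-7/FROM-prim-hp-7-g45-JBERN-PLUS.md` §2).  On a "Reimer fibre" two of the three copies of a
3-colouring are COMPLEMENTARY subsets `s, sᶜ` of a finite set of free edges.  Every reduction step of the memo (attaching a graph
at one vertex, replacing an edge by an arbitrary two-terminal graph, the markerless case, removing the edge `xo`) needs exactly
one input: given an UPPER family `𝒞` (e.g. "this copy connects the two poles") and a MONOTONE code `f` (the colour-3 cluster
edge set), there is a BIJECTION from the fibre sources `𝒞ᶜˢ \ 𝒞 = {s : sᶜ ∈ 𝒞, s ∉ 𝒞}` onto the fibre targets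
`𝒞 \ 𝒞ᶜˢ = {s : s ∈ 𝒞, sᶜ ∉ 𝒞}` that never decreases the code.  This file proves it (`exists_code_monotone_bijection`) from
* the Harris–Kleitman/complementation inequality `#(𝒰 ∩ 𝒞ᶜˢ) ≤ #(𝒰 ∩ 𝒞)` for upper families, already in the tree as
  `…SahiGridPattern.card_inter_compls_le` (the `k = 2` row of the Sahi comb hierarchy), and
* Hall's marriage theorem (`Fintype.all_card_le_filter_rel_iff_exists_injective`),
plus the complementation bijection for the cardinality count.  [this work]
-/

namespace Summit.CriticalPhenomena.PercolationContinuityZ3.Theorems.JBern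

open Finset Function
open scoped FinsetFamily

variable {α : Type*} [DecidableEq α] [Fintype α]

/-- The two sides of a fibre are equinumerous: `#(𝒞ᶜˢ \ 𝒞) = #(𝒞 \ 𝒞ᶜˢ)` (complementation `s ↦ sᶜ`). [this work] -/
theorem card_compls_sdiff_eq (𝒞 : Finset (Finset α)) : #(𝒞ᶜˢ \ 𝒞) = #(𝒞 \ 𝒞ᶜˢ) := by
  refine card_bij (fun s _ => sᶜ) (fun s hs => ?_) (fun s _ t _ h => compl_injective h) (fun t ht => ?_)
  · rw [mem_sdiff, mem_compls] at hs
    rw [mem_sdiff, mem_compls, compl_compl]; exact hs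
  · rw [mem_sdiff, mem_compls] at ht
    exact ⟨tᶜ, by rw [mem_sdiff, mem_compls, compl_compl]; exact ⟨ht.1, ht.2⟩, compl_compl t⟩

/-- **Weighted fibre inequality.**  For upper families `𝒰, 𝒞`: the fibre sources inside `𝒰` are at most as many as the fibre targets
inside `𝒰`, `#(𝒰 ∩ (𝒞ᶜˢ \ 𝒞)) ≤ #(𝒰 ∩ (𝒞 \ 𝒞ᶜˢ))` — Harris–Kleitman plus complementation (`card_inter_compls_le`) after cancelling the
common part `𝒰 ∩ 𝒞 ∩ 𝒞ᶜˢ`. [this work] -/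
theorem card_inter_compls_sdiff_le (𝒰 𝒞 : Finset (Finset α)) (h𝒰 : IsUpperSet (𝒰 : Set (Finset α)))
    (h𝒞 : IsUpperSet (𝒞 : Set (Finset α))) : #(𝒰 ∩ (𝒞ᶜˢ \ 𝒞)) ≤ #(𝒰 ∩ (𝒞 \ 𝒞ᶜˢ)) := by
  have hk : #(𝒰 ∩ 𝒞ᶜˢ) ≤ #(𝒰 ∩ 𝒞) := SahiGridPattern.card_inter_compls_le h𝒰 h𝒞
  have h1 : 𝒰 ∩ (𝒞ᶜˢ \ 𝒞) = (𝒰 ∩ 𝒞ᶜˢ) \ (𝒰 ∩ 𝒞ᶜˢ ∩ 𝒞) := by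
    ext s; simp only [mem_inter, mem_sdiff]; tauto
  have h2 : 𝒰 ∩ (𝒞 \ 𝒞ᶜˢ) = (𝒰 ∩ 𝒞) \ (𝒰 ∩ 𝒞ᶜˢ ∩ 𝒞) := by
    ext s; simp only [mem_inter, mem_sdiff]; tauto
  have hs1 : 𝒰 ∩ 𝒞ᶜˢ ∩ 𝒞 ⊆ 𝒰 ∩ 𝒞ᶜˢ := inter_subset_left
  have hs2 : 𝒰 ∩ 𝒞ᶜˢ ∩ 𝒞 ⊆ 𝒰 ∩ 𝒞 := by
    intro s hs; simp only [mem_inter] at hs ⊢; exact ⟨hs.1.1, hs.2⟩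
  rw [h1, h2, card_sdiff_of_subset hs1, card_sdiff_of_subset hs2]
  omega

/-- **Fibre matching lemma** (the single input of the 1-sum/2-sum reduction of J-BERN⁺).  For an upper family `𝒞` of subsets of a
finite set and a monotone code `f` into any preorder, there is a bijection from the fibre sources `𝒞ᶜˢ \ 𝒞 = {s : sᶜ ∈ 𝒞, s ∉ 𝒞}` onto
the fibre targets `𝒞 \ 𝒞ᶜˢ = {s : s ∈ 𝒞, sᶜ ∉ 𝒞}` that never decreases the code.  Proof: Hall's theorem; Hall's condition for a set
`A` of sources is the weighted fibre inequality for the upper family `𝒰 = {s : ∃ a ∈ A, f a ≤ f s}`. [this work] -/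
theorem exists_code_monotone_bijection {β : Type*} [Preorder β] (𝒞 : Finset (Finset α))
    (h𝒞 : IsUpperSet (𝒞 : Set (Finset α))) (f : Finset α → β) (hf : Monotone f) :
    ∃ ψ : (𝒞ᶜˢ \ 𝒞 : Finset (Finset α)) → (𝒞 \ 𝒞ᶜˢ : Finset (Finset α)),
      Bijective ψ ∧ ∀ s, f s.1 ≤ f (ψ s).1 := by
  classical
  have hall : ∀ A : Finset (𝒞ᶜˢ \ 𝒞 : Finset (Finset α)),
      #A ≤ #({b : (𝒞 \ 𝒞ᶜˢ : Finset (Finset α)) | ∃ a ∈ A, f a.1 ≤ f b.1} : Finset _) := by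
    intro A
    set 𝒰 : Finset (Finset α) := Finset.univ.filter (fun s => ∃ a ∈ A, f a.1 ≤ f s) with h𝒰def
    have h𝒰 : IsUpperSet (𝒰 : Set (Finset α)) := by
      intro s t hst hs
      rw [Finset.mem_coe, h𝒰def, mem_filter] at hs ⊢
      obtain ⟨a, ha, hle⟩ := hs.2
      exact ⟨mem_univ _, a, ha, hle.trans (hf hst)⟩
    have hA : #A ≤ #(𝒰 ∩ (𝒞ᶜˢ \ 𝒞)) := by
      have : A.map (Embedding.subtype _) ⊆ 𝒰 ∩ (𝒞ᶜˢ \ 𝒞) := by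
        intro s hs
        rw [mem_map] at hs
        obtain ⟨a, ha, rfl⟩ := hs
        refine mem_inter.2 ⟨?_, a.2⟩
        rw [h𝒰def, mem_filter]; exact ⟨mem_univ _, a, ha, le_rfl⟩
      simpa using card_le_card this
    have hB : #(𝒰 ∩ (𝒞 \ 𝒞ᶜˢ)) ≤ #({b : (𝒞 \ 𝒞ᶜˢ : Finset (Finset α)) | ∃ a ∈ A, f a.1 ≤ f b.1} : Finset _) := by
      have himg : 𝒰 ∩ (𝒞 \ 𝒞ᶜˢ) ⊆
          ({b : (𝒞 \ 𝒞ᶜˢ : Finset (Finset α)) | ∃ a ∈ A, f a.1 ≤ f b.1} : Finset _).map (Embedding.subtype _) := by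
        intro s hs
        rw [mem_inter, h𝒰def, mem_filter] at hs
        rw [mem_map]
        refine ⟨⟨s, hs.2⟩, ?_, rfl⟩
        rw [mem_filter]; exact ⟨mem_univ _, hs.1.2⟩
      simpa using card_le_card himg
    exact hA.trans ((card_inter_compls_sdiff_le 𝒰 𝒞 h𝒰 h𝒞).trans hB)
  obtain ⟨ψ, hinj, hψ⟩ := (Fintype.all_card_le_filter_rel_iff_exists_injective
    (fun (a : (𝒞ᶜˢ \ 𝒞 : Finset (Finset α))) (b : (𝒞 \ 𝒞ᶜˢ : Finset (Finset α))) => f a.1 ≤ f b.1)).1 hall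
  refine ⟨ψ, ?_, hψ⟩
  rw [Fintype.bijective_iff_injective_and_card]
  have h1 : Fintype.card (𝒞ᶜˢ \ 𝒞 : Finset (Finset α)) = #(𝒞ᶜˢ \ 𝒞) := Fintype.card_coe _
  have h2 : Fintype.card (𝒞 \ 𝒞ᶜˢ : Finset (Finset α)) = #(𝒞 \ 𝒞ᶜˢ) := Fintype.card_coe _
  exact ⟨hinj, by rw [h1, h2, card_compls_sdiff_eq]⟩

end Summit.CriticalPhenomena.PercolationContinuityZ3.Theorems.JBern
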